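import Summits.ResolutionOfSingularities.ResolutionOfSingularities.Theorems.PurelyInseparableDim4SwapRelation
import Summits.ResolutionOfSingularities.ResolutionOfSingularities.Theorems.PurelyInseparableDim4ResConePowerCone
import HarnessLib
import HarnessLib.Audit.Tags

/-!
# Purely inseparable four-folds — THE LINEAR PART OF A DIAGONAL SUBSTITUTION: `θ(x_{π i}) = x_i · e_i` acts on forms of
# degree `o` as its 1-jet `J(x_{π i}) = e_i(0) · x_i` modulo `𝔪₀^{o+1}` (cell `res-dim4-pi`, K2(p) lane, slice B brick K24a, R1
# part «cone through the swap», file 1 of 2)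

[OURS · counted 0 · cell `res-dim4-pi` · K2(p) lane (holder res-dim4-p-12 g3; K24a-R1 «rotation» = res-dim4-p-1, plan R1′ bus
2026-08-29 04:06Z); seat res-dim4-p-1 g4; the diagonal shape is the swap substitution of res-dim4-p-7 g3's SN1
`…SwapIdentity` (`θ(x^A_f) = x_a (x_f + τ)`, `θ(x^A_i) = x_i P`, `θ(x^A_a) = x_f (−τ′P)` — no additive `G`).]  Nothing here proves
K2(p)/K2(5), `NoIsolatedTrap p p` or resolution of singularities in dimension ≥ 4 / characteristic `p`.  AI kernel work, weaker
than expert review.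

For a DIAGONAL substitution `θ` along a letter bijection `π` (`θ (π i) = x_i · e_i`, `e_i(0) ≠ 0`) write
`J k := e_{π⁻¹ k}(0) · x_{π⁻¹ k}` for its linear part and `n♯ := n ∘ π` (`Finsupp.mapDomain π⁻¹ n`) for the renamed exponent.
* `aeval_monomial_sub_mem`, **`aeval_sub_aeval_linearPart_mem`** — `θ(P) − J(P) ∈ 𝔪₀^{o+1}` for `P` with all monomials of
  degree `≥ o`;
* **`coeff_aeval_linearPart`** — `coeff_{n♯} (J P) = (∏ e(0)^n) · coeff_n P`; hence `J` is injective
  (`eq_zero_of_aeval_linearPart_eq_zero`) and keeps homogeneity (`isHomogeneous_aeval_linearPart`);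
* `ordZero_initialForm_of_add_mem` — `H ≠ 0` homogeneous of degree `o` plus `𝔪₀^{o+1}` has order `o` and initial form `H`.

File 2 (`…ResConeSwapCone`): initial form / residual form / power cone / `e_G` through `F_B = clean(U^p·θ(F_A)) + E`.
[cite: CossartJannsenSaito2020, Def. 2.8] [cite: Hauser2010, §§F–G] bears_on: LADDER-RESOLUTION:D157-DOOR2 (res-dim4-pi · K2(p) ·
slice B · K24a-R1).  Supports stmt-ResolutionOfSingularities-16155 (helper).
-/

set_option linter.dupNamespace false -- mandated namespace of this single-conjunct summit

noncomputable section

namespace Summit.ResolutionOfSingularities.ResolutionOfSingularities.Theorems.PIDim4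

namespace ResCone

open MvPolynomial Finset
open Literature.AlgebraicGeometry.Resolution
open Literature.AlgebraicGeometry.Resolution.CentreBlowup
open Literature.AlgebraicGeometry.Resolution.Hauser2010
open Literature.AlgebraicGeometry.Resolution.HauserPerlega2019
open PointBlowup (polarMap additiveSubspace)

variable {K : Type} [Field K]

/-! ## 1. The linear part of a diagonal substitution -/

section Diagonal

variable {π : Equiv.Perm (Fin 4)} {θ e : Fin 4 → MvPolynomial (Fin 4) K}

/-- A diagonal substitution on the variables: `θ k = x_{π⁻¹ k} · e_{π⁻¹ k}`. [folklore] -/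
theorem diag_apply (hθ : ∀ i, θ (π i) = X i * e i) (k : Fin 4) : θ k = X (π.symm k) * e (π.symm k) := by
  conv_lhs => rw [← π.apply_symm_apply k]
  exact hθ _

/-- A monomial `x^n` renamed along `π⁻¹` is the monomial `x^{n ∘ π}` (`Finsupp.mapDomain π⁻¹`). [folklore] -/
theorem prod_X_pow_eq_monomial (π : Equiv.Perm (Fin 4)) (n : Fin 4 →₀ ℕ) :
    (n.prod fun k m => (X (π.symm k) : MvPolynomial (Fin 4) K) ^ m) = monomial (n.mapDomain π.symm) 1 := by
  rw [monomial_eq, C_1, one_mul, Finsupp.prod_mapDomain_index (fun _ => pow_zero _) (fun _ _ _ => pow_add _ _ _)]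

/-- The degree of a renamed exponent. [folklore] -/
theorem degree_mapDomain_perm (π : Equiv.Perm (Fin 4)) (n : Fin 4 →₀ ℕ) : (n.mapDomain π).degree = n.degree := by
  rw [Finsupp.degree_eq_sum, Finsupp.degree_eq_sum, ← Finsupp.sum_fintype n (fun _ m => m) (fun _ => rfl),
    ← Finsupp.sum_fintype (n.mapDomain π) (fun _ m => m) (fun _ => rfl), Finsupp.sum_mapDomain_index (fun _ => rfl)
    (fun _ _ _ => rfl)]

/-- A renamed exponent, letter by letter: `(n ∘ π)(i) = n (π i)`. [folklore] -/
theorem mapDomain_symm_apply (π : Equiv.Perm (Fin 4)) (n : Fin 4 →₀ ℕ) (i : Fin 4) :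
    n.mapDomain π.symm i = n (π i) := by
  have h := Finsupp.mapDomain_apply π.symm.injective n (π i)
  rwa [Equiv.symm_apply_apply] at h

/-- A product of powers of constants is a constant. [folklore] -/
theorem prod_C_pow_eq (n : Fin 4 →₀ ℕ) (g : Fin 4 → K) :
    (n.prod fun k m => (C (g k) : MvPolynomial (Fin 4) K) ^ m) = C (n.prod fun k m => g k ^ m) := by
  rw [Finsupp.prod, Finsupp.prod, map_prod]
  simp only [map_pow]

/-- The monomial `x^m` lies in `𝔪₀^{|m|}`. [folklore] -/
theorem monomial_mem_originIdeal_pow (m : Fin 4 →₀ ℕ) (c : K) : monomial m c ∈ originIdeal K ^ m.degree := by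
  classical
  rw [IsolationCert.mem_originIdeal_pow_iff]
  intro d hd
  rw [coeff_monomial, if_neg]
  rintro rfl
  exact lt_irrefl _ hd

/-- **The diagonal substitution on a monomial, to first order**: `θ(c·x^n) − J(c·x^n) ∈ 𝔪₀^{|n|+1}` where `J` is the linear
part of `θ` (`J k = e_{π⁻¹k}(0) · x_{π⁻¹ k}`). [folklore] -/
theorem aeval_monomial_sub_mem (hθ : ∀ i, θ (π i) = X i * e i) (n : Fin 4 →₀ ℕ) (c : K) :
    aeval θ (monomial n c) - aeval (fun k => C (constantCoeff (e (π.symm k))) * X (π.symm k)) (monomial n c) ∈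
      originIdeal K ^ (n.degree + 1) := by
  classical
  have hθ' : θ = fun k => X (π.symm k) * e (π.symm k) := funext (diag_apply hθ)
  rw [aeval_monomial, aeval_monomial, algebraMap_eq, hθ']
  simp only [mul_pow]
  rw [Finsupp.prod_mul, Finsupp.prod_mul, prod_X_pow_eq_monomial, prod_C_pow_eq]
  set Mn : MvPolynomial (Fin 4) K := monomial (Finsupp.mapDomain (⇑(Equiv.symm π)) n) 1 with hMn
  set En : MvPolynomial (Fin 4) K := n.prod fun k m => e (π.symm k) ^ m with hEn
  set ε : K := n.prod fun k m => constantCoeff (e (π.symm k)) ^ m with hε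
  rw [show C c * (Mn * En) - C c * (C ε * Mn) = (C c * Mn) * (En - C ε) by ring, hMn, C_mul_monomial, mul_one]
  rw [pow_succ]
  refine Ideal.mul_mem_mul ?_ ?_
  · rw [← degree_mapDomain_perm π.symm n]; exact monomial_mem_originIdeal_pow _ c
  · rw [originIdeal, RingHom.mem_ker, map_sub, MvPolynomial.eval_C, hEn, hε, Finsupp.prod, map_prod]
    simp only [map_pow, MvPolynomial.eval_zero]
    rw [Finsupp.prod, sub_self]

/-- **To first order a diagonal substitution is its linear part**: for `P ∈ 𝔪₀^o` (all monomials of degree `≥ o`),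
`θ(P) − J(P) ∈ 𝔪₀^{o+1}`. [folklore] -/
theorem aeval_sub_aeval_linearPart_mem (hθ : ∀ i, θ (π i) = X i * e i) {P : MvPolynomial (Fin 4) K} {o : ℕ}
    (hP : ∀ n ∈ P.support, o ≤ n.degree) :
    aeval θ P - aeval (fun k => C (constantCoeff (e (π.symm k))) * X (π.symm k)) P ∈ originIdeal K ^ (o + 1) := by
  classical
  rw [show aeval θ P - aeval (fun k => C (constantCoeff (e (π.symm k))) * X (π.symm k)) P =
      ∑ n ∈ P.support, (aeval θ (monomial n (coeff n P)) -
        aeval (fun k => C (constantCoeff (e (π.symm k))) * X (π.symm k)) (monomial n (coeff n P))) by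
    conv_lhs => rw [P.as_sum]
    rw [map_sum, map_sum, ← Finset.sum_sub_distrib]]
  refine Ideal.sum_mem _ fun n hn => ?_
  exact Ideal.pow_le_pow_right (by have := hP n hn; omega) (aeval_monomial_sub_mem hθ n (coeff n P))

/-- **Coefficients under the linear part**: `coeff_{n∘π} (J P) = (∏ e_i(0)^{n(π i)}) · coeff_n P`. [folklore] -/
theorem coeff_aeval_linearPart (e : Fin 4 → MvPolynomial (Fin 4) K) (π : Equiv.Perm (Fin 4)) (P : MvPolynomial (Fin 4) K)
    (n : Fin 4 →₀ ℕ) :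
    coeff (n.mapDomain π.symm) (aeval (fun k => C (constantCoeff (e (π.symm k))) * X (π.symm k)) P) =
      (n.prod fun k m => constantCoeff (e (π.symm k)) ^ m) * coeff n P := by
  classical
  have hinj : Function.Injective (fun m : Fin 4 →₀ ℕ => m.mapDomain (π.symm : Fin 4 → Fin 4)) :=
    Finsupp.mapDomain_injective π.symm.injective
  have key : ∀ m : Fin 4 →₀ ℕ, aeval (fun k => C (constantCoeff (e (π.symm k))) * X (π.symm k)) (monomial m (coeff m P)) =
      monomial (m.mapDomain π.symm) ((m.prod fun k j => constantCoeff (e (π.symm k)) ^ j) * coeff m P) := by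
    intro m
    rw [aeval_monomial, algebraMap_eq]
    simp only [mul_pow]
    rw [Finsupp.prod_mul, prod_X_pow_eq_monomial, prod_C_pow_eq, C_mul_monomial, C_mul_monomial, mul_one, mul_comm]
  conv_lhs => rw [P.as_sum, map_sum]
  simp_rw [key]
  rw [coeff_sum]
  simp_rw [coeff_monomial]
  rw [Finset.sum_eq_single n]
  · rw [if_pos rfl]
  · intro m _ hmn
    rw [if_neg fun h => hmn (hinj h)]
  · intro hn
    rw [if_pos rfl, MvPolynomial.notMem_support_iff.mp hn, mul_zero]

/-- The product of the unit values is non-zero. [folklore] -/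
theorem prod_constantCoeff_pow_ne_zero {e : Fin 4 → MvPolynomial (Fin 4) K} (he : ∀ i, constantCoeff (e i) ≠ 0)
    (π : Equiv.Perm (Fin 4)) (n : Fin 4 →₀ ℕ) : (n.prod fun k m => constantCoeff (e (π.symm k)) ^ m) ≠ 0 := by
  rw [Finsupp.prod]
  exact Finset.prod_ne_zero_iff.mpr fun k _ => pow_ne_zero _ (he _)

/-- **The linear part is injective**: `J P = 0 ⇒ P = 0`. [folklore] -/
theorem eq_zero_of_aeval_linearPart_eq_zero {e : Fin 4 → MvPolynomial (Fin 4) K} (he : ∀ i, constantCoeff (e i) ≠ 0)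
    (π : Equiv.Perm (Fin 4)) {P : MvPolynomial (Fin 4) K}
    (h : aeval (fun k => C (constantCoeff (e (π.symm k))) * X (π.symm k)) P = 0) : P = 0 := by
  ext n
  have hc := coeff_aeval_linearPart e π P n
  rw [h, coeff_zero] at hc
  rw [coeff_zero]
  rcases mul_eq_zero.mp hc.symm with h0 | h0
  · exact absurd h0 (prod_constantCoeff_pow_ne_zero he π n)
  · exact h0

/-- The linear part preserves homogeneity. [folklore] -/
theorem isHomogeneous_aeval_linearPart (e : Fin 4 → MvPolynomial (Fin 4) K) (π : Equiv.Perm (Fin 4))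
    {P : MvPolynomial (Fin 4) K} {o : ℕ} (hP : P.IsHomogeneous o) :
    (aeval (fun k => C (constantCoeff (e (π.symm k))) * X (π.symm k)) P).IsHomogeneous o := by
  have h := hP.aeval (fun k => C (constantCoeff (e (π.symm k))) * X (π.symm k)) (n := 1) (fun k => by
    have h1 := (isHomogeneous_C (Fin 4) (constantCoeff (e (π.symm k)))).mul (isHomogeneous_X K (π.symm k))
    rwa [zero_add] at h1)
  rwa [one_mul] at h

/-- A non-zero homogeneous polynomial of degree `o` plus an element of `𝔪₀^{o+1}` has order `o` and initial form the
homogeneous part. [folklore] -/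
theorem ordZero_initialForm_of_add_mem {H R : MvPolynomial (Fin 4) K} {o : ℕ} (hH : H.IsHomogeneous o) (hH0 : H ≠ 0)
    (hR : R ∈ originIdeal K ^ (o + 1)) : ordZero (H + R) = o ∧ initialForm (H + R) = H := by
  classical
  have hoH : ordZero H = o := by
    refine le_antisymm ?_ (le_ordZero_of_isHomogeneous hH)
    obtain ⟨d, hd⟩ := MvPolynomial.ne_zero_iff.mp hH0
    have hdeg : d.degree = o := by
      have := hH hd
      rwa [weight_one_eq_degree] at this
    rw [← hdeg]
    exact Literature.Barriers.ResolutionOfSingularities.ordZero_le_of_coeff_ne_zero _ _ hd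
  have ho : ordZero (H + R) = o := ApproxCoordChange.ordZero_add_of_mem_pow hoH hR (Nat.lt_succ_self o)
  refine ⟨ho, ?_⟩
  rw [Directrix.initialForm_eq_homogeneousComponent ho, map_add, homogeneousComponent_of_mem hH, if_pos rfl,
    add_eq_left]
  ext d
  rw [coeff_homogeneousComponent, coeff_zero]
  split_ifs with hd
  · exact (IsolationCert.mem_originIdeal_pow_iff _ _).mp hR d (by omega)
  · rfl

end Diagonal

end ResCone

end Summit.ResolutionOfSingularities.ResolutionOfSingularities.Theorems.PIDim4

end
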